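import Literature.NumberTheory.EllipticCurves.GreenbergSelmerCofreeReductionPk
import HarnessLib

/-!
# `T/p^kT ≅ A[p^k]`: kernel and image of `t ↦ p^{-k}t mod 𝒪ⁿ` (`GreenbergSelmer.divPowCofreeMk`), and the finiteness of
# `A_ρ[p^k]` from that of `𝒪/p^k` (proofs only)

Topic `NumberTheory/EllipticCurves`, namespace `Literature.NumberTheory.EllipticCurves.GreenbergSelmer`. THEOREMS ONLY (no definition, no
named fact, no instance; D-0026). Sequel of `GreenbergSelmerCofreeReductionPk.lean` (route lead, PIN-SPEC-S2-g16 D1: the reduction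
`divPowCofreeMk S ρ k : T_ρ = 𝒪ⁿ → A_ρ = Fⁿ/𝒪ⁿ`, `t ↦ p^{-k} t mod 𝒪ⁿ`, for `𝒪 = padicCoeffIntegers S`, `F = padicCoeffField S`), written
by the definition typer `bsd-wall-defn-rho` (cell `bsd-wall`): the two facts that make "`T/p^kT ≅ A[p^k]`" (Greenberg 1989 p. 98:
"`A_p = V_p/T_p`, which as a group is just `(ℚ_p/ℤ_p)^d`"; Kato §13.8 `T → T/p^k`) precise for that map —

* `divPowCofreeMk_eq_zero_iff` — **kernel**: `p^{-k}t ≡ 0 mod 𝒪ⁿ ⟺ t ∈ p^k𝒪ⁿ` (coordinatewise `t_i ∈ p^k𝒪`); `divPowCofreeMk_eq_iff`;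
* `exists_divPowCofreeMk_eq_of_zsmul_eq_zero`, `divPowCofreeMkTorsion_surjective` — **image**: every `p^k`-torsion class of `A_ρ` is
  `p^{-k}t mod 𝒪ⁿ` for some `t ∈ 𝒪ⁿ` (so `range = A_ρ[p^k]`, `range_divPowCofreeMk_eq_torsionBy`);
* `finite_cofreeTorsionBy_of_finite_quotient` — **`A_ρ[p^k]` is finite when `𝒪/p^k` is** (it is the image of `(𝒪/p^k)ⁿ`): the
  `[Finite M]` of local Tate duality for `M = A_ρ[p^k]` (memo PIN-SPEC-S2-g16 §4, D2(d)), complementing the transport-based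
  `finite_cofreeTorsionBy_of_theta` of `CyclotomicLayerThetaKummer.lean`.

References: [Greenberg1989] §1 p. 98; [Kato2004Asterisque] §13.8 (p. 228); [EmertonPollackWeston2006] §3.1.
-/

noncomputable section

open scoped Classical
open Field IsDedekindDomain
open Literature.NumberTheory.GaloisRepresentations

namespace Literature.NumberTheory.EllipticCurves.GreenbergSelmer

universe u

section DivPow

variable {p : ℕ} [Fact p.Prime] (S : Set (PadicAlgCl p)) {G : Type u} [Group G] [TopologicalSpace G] {n : ℕ}
  (ρ : FramedRep G (padicCoeffIntegers S) n) (k : ℕ)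

/-- The structure map `𝒪 → F = ℚ_p(S)` followed by `F ⊂ ℚ̄_p` is the inclusion `𝒪 ⊂ ℚ̄_p`. [folklore] -/
private theorem coe_algebraMap_padicCoeffIntegers' (x : padicCoeffIntegers S) :
    ((algebraMap (padicCoeffIntegers S) (padicCoeffField S) x : padicCoeffField S) : PadicAlgCl p) = (x : PadicAlgCl p) :=
  rfl

/-- The structure map `𝒪 → F` is injective (both are subsets of `ℚ̄_p`). [folklore] -/
private theorem algebraMap_padicCoeffIntegers_injective :
    Function.Injective (algebraMap (padicCoeffIntegers S) (padicCoeffField S)) := fun x y h ↦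
  Subtype.ext (by rw [← coe_algebraMap_padicCoeffIntegers' S x, ← coe_algebraMap_padicCoeffIntegers' S y, h])

/-- **Kernel of `t ↦ p^{-k}t mod 𝒪ⁿ`**: `divPowCofreeMk S ρ k t = 0 ⟺ t ∈ p^k 𝒪ⁿ` (coordinatewise `t_i ∈ p^k𝒪`), i.e. the reduction
`T_ρ → A_ρ[p^k]` has kernel exactly `p^k T_ρ` ("`T/p^kT ≅ A[p^k]`", injectivity half). [cite: Greenberg1989, §1 p. 98]
[cite: Kato2004Asterisque, §13.8 (p. 228)] -/
theorem divPowCofreeMk_eq_zero_iff (t : Fin n → padicCoeffIntegers S) :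
    divPowCofreeMk S ρ k t = 0 ↔ ∀ i, t i ∈ Ideal.span {((p : padicCoeffIntegers S)) ^ k} := by
  have hpk : ((p : padicCoeffField S)) ^ k ≠ 0 := pow_ne_zero _ (Nat.cast_ne_zero.mpr (Fact.out : p.Prime).ne_zero)
  rw [divPowCofreeMk_apply, ← LinearMap.mem_ker, ker_cofreeMk, mem_lattice_iff]
  constructor
  · rintro ⟨y, hy⟩ i
    refine Ideal.mem_span_singleton'.mpr ⟨y i, algebraMap_padicCoeffIntegers_injective S ?_⟩
    have hi := congr_fun hy i
    rw [Pi.smul_apply, smul_eq_mul] at hi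
    rw [map_mul, map_pow, map_natCast, hi, inv_pow, mul_comm, ← mul_assoc, mul_inv_cancel₀ hpk, one_mul]
  · intro h
    choose y hy using fun i ↦ Ideal.mem_span_singleton'.mp (h i)
    refine ⟨y, funext fun i ↦ ?_⟩
    rw [Pi.smul_apply, smul_eq_mul, ← hy i, map_mul, map_pow, map_natCast, inv_pow, mul_left_comm,
      inv_mul_cancel₀ hpk, mul_one]

/-- `p^{-k}t ≡ p^{-k}t' mod 𝒪ⁿ ⟺ t ≡ t' mod p^k𝒪ⁿ`. [cite: Greenberg1989, §1 p. 98] -/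
theorem divPowCofreeMk_eq_iff (t t' : Fin n → padicCoeffIntegers S) :
    divPowCofreeMk S ρ k t = divPowCofreeMk S ρ k t' ↔ ∀ i, t i - t' i ∈ Ideal.span {((p : padicCoeffIntegers S)) ^ k} := by
  rw [← sub_eq_zero, ← map_sub, divPowCofreeMk_eq_zero_iff]
  rfl

/-- **Image of `t ↦ p^{-k}t mod 𝒪ⁿ`**: every class `a ∈ A_ρ` killed by `p^k` is `p^{-k}t mod 𝒪ⁿ` for some `t ∈ 𝒪ⁿ` (`a = x mod 𝒪ⁿ` with
`p^k x ∈ 𝒪ⁿ`; take `t = p^k x`) — the surjectivity half of "`T/p^kT ≅ A[p^k]`". [cite: Greenberg1989, §1 p. 98] -/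
theorem exists_divPowCofreeMk_eq_of_zsmul_eq_zero {a : Cofree ρ (padicCoeffField S)} (ha : ((p ^ k : ℕ) : ℤ) • a = 0) :
    ∃ t : Fin n → padicCoeffIntegers S, divPowCofreeMk S ρ k t = a := by
  have hpk : ((p : padicCoeffField S)) ^ k ≠ 0 := pow_ne_zero _ (Nat.cast_ne_zero.mpr (Fact.out : p.Prime).ne_zero)
  obtain ⟨x, rfl⟩ := cofreeMk_surjective (padicCoeffField S) ρ a
  have hmem : ((p ^ k : ℕ) : ℤ) • x ∈ LinearMap.ker (cofreeMk (padicCoeffField S) ρ) := by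
    rw [LinearMap.mem_ker, map_zsmul]
    exact ha
  rw [ker_cofreeMk, mem_lattice_iff] at hmem
  obtain ⟨y, hy⟩ := hmem
  refine ⟨y, ?_⟩
  rw [divPowCofreeMk_apply, hy, natCast_zsmul, ← Nat.cast_smul_eq_nsmul (padicCoeffField S), Nat.cast_pow, smul_smul,
    inv_pow, inv_mul_cancel₀ hpk, one_smul]

/-- **`range (t ↦ p^{-k}t mod 𝒪ⁿ) = A_ρ[p^k]`** (`pow_smul_divPowCofreeMk` and `exists_divPowCofreeMk_eq_of_zsmul_eq_zero`).
[cite: Greenberg1989, §1 p. 98] -/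
theorem range_divPowCofreeMk_eq_torsionBy :
    (divPowCofreeMk S ρ k).range = AddSubgroup.torsionBy (Cofree ρ (padicCoeffField S)) ((p ^ k : ℕ) : ℤ) := by
  ext a
  rw [AddMonoidHom.mem_range, AddSubgroup.torsionBy, Submodule.mem_toAddSubgroup, Submodule.mem_torsionBy_iff]
  constructor
  · rintro ⟨t, rfl⟩
    rw [natCast_zsmul]
    exact pow_smul_divPowCofreeMk S ρ k t
  · exact fun ha ↦ exists_divPowCofreeMk_eq_of_zsmul_eq_zero S ρ k ha

end DivPow

section Torsion

variable {p : ℕ} [Fact p.Prime] (S : Set (PadicAlgCl p)) {n : ℕ} (ρ : FramedGaloisRep ℚ (padicCoeffIntegers S) n) (k : ℕ)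

/-- **`divPowCofreeMkTorsion S ρ k : T_ρ → A_ρ[p^k]` is onto** (`T/p^kT ≅ A[p^k]`). [cite: Greenberg1989, §1 p. 98] -/
theorem divPowCofreeMkTorsion_surjective : Function.Surjective (divPowCofreeMkTorsion S ρ k) := fun a ↦ by
  obtain ⟨t, ht⟩ := exists_divPowCofreeMk_eq_of_zsmul_eq_zero S ρ k
    (a := (a : Cofree ρ (padicCoeffField S))) ((Submodule.mem_torsionBy_iff (R := ℤ) _ _).mp a.2)
  exact ⟨t, Subtype.ext ht⟩

/-- A map that factors through a surjection onto a finite type has finite range. [folklore] -/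
private theorem finite_range_of_factors' {X Q Y : Type*} [Finite Q] (π : X → Q) (hπ : Function.Surjective π) (ψ : X → Y)
    (h : ∀ x x', π x = π x' → ψ x = ψ x') : (Set.range ψ).Finite := by
  refine (Set.finite_range (ψ ∘ Function.surjInv hπ)).subset ?_
  rintro _ ⟨x, rfl⟩
  exact ⟨π x, h _ _ (Function.surjInv_eq hπ (π x))⟩

/-- **`A_ρ[p^k]` is finite when `𝒪/p^k` is** — it is the image of `(𝒪/p^k)ⁿ` under `t ↦ p^{-k}t mod 𝒪ⁿ`
(`divPowCofreeMkTorsion_surjective`, `divPowCofreeMk_eq_iff`); "`A_p … as a group is just (ℚ_p/ℤ_p)^d`", so `A_p[p^k] ≃ (ℤ/p^k)^d`.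
This is the `[Finite M]` that local Tate duality (`DiscreteGaloisModule.localTatePairing`, `tateDual`) asks of `M = A_ρ[p^k]`; for the
valuation ring of a finite extension of `ℚ_p` the hypothesis holds (`𝒪/p^k` finite). [cite: Greenberg1989, §1 p. 98] -/
theorem finite_cofreeTorsionBy_of_finite_quotient
    [Finite (padicCoeffIntegers S ⧸ Ideal.span {((p : padicCoeffIntegers S)) ^ k})] :
    Finite ↥(AddSubgroup.torsionBy (Cofree ρ (padicCoeffField S)) ((p ^ k : ℕ) : ℤ)) := by
  have hrange : (Set.range (divPowCofreeMkTorsion S ρ k)).Finite := by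
    refine finite_range_of_factors'
      (Q := Fin n → padicCoeffIntegers S ⧸ Ideal.span {((p : padicCoeffIntegers S)) ^ k})
      (fun t i ↦ Ideal.Quotient.mk _ (t i)) (fun q ↦ ?_) (divPowCofreeMkTorsion S ρ k) fun t t' htt' ↦ ?_
    · choose t ht using fun i ↦ Ideal.Quotient.mk_surjective (q i)
      exact ⟨t, funext fun i ↦ ht i⟩
    · apply Subtype.ext
      rw [coe_divPowCofreeMkTorsion_apply, coe_divPowCofreeMkTorsion_apply, divPowCofreeMk_eq_iff]
      intro i
      exact Ideal.Quotient.eq.mp (congr_fun htt' i)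
  rw [(divPowCofreeMkTorsion_surjective S ρ k).range_eq] at hrange
  exact Set.finite_univ_iff.mp hrange

end Torsion

end Literature.NumberTheory.EllipticCurves.GreenbergSelmer

end
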